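import Summits.QuantumFields.BalabanUV.T4Continuum.Support.ShellMeasureDecayRowsLevelOpCells
import Summits.QuantumFields.BalabanUV.Beta.MultiscaleDecayDirichlet

/-!
# `T4Continuum.ShellMeasureDecayRowsDirInvCells` — ROW J3, SECTIONED HALF: the cell-to-cell ℓ² bound and the E6-row shape for the
# DIRICHLET-SECTIONED MODEL operator — pv21's `dirInv (levelOp) χ = Ω₀(Ω₀AΩ₀ + (1 − Ω₀))⁻¹Ω₀` on EVERY domain `χ` — with the SAME
# rate and the same local prefactors as the full inverse (denominator `min(μ₀, 1)`), uniformly in the domain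
(cell `pub-balaban`, sub-cell `t4`, spine estimate NE7c (node U5b); NE7c ROUND-2 crew `t4-ne7c-formalise-*`, unit
`b2b-balaban-t4-ne7c-formalise-leaf-02` gen 13; owner table `t4/b2b-balaban-t4-ne7c-p1/LEAVES-NE7c-P1.md` estimate-lane ROW **J3**
(R-ne7cp1-g37-7 (b): «E6-SHAPE FOR A `levelOp`-SECTIONED OPERATOR … from `decay_dirInv_cov` + `…L2Cells`») — file 2 of J3: file 1
`ShellMeasureDecayRowsLevelOpCells` did the FULL inverse through `MultiscaleCombesThomasL2Cells`; the cell-to-cell ℓ² bound for the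
DIRICHLET inverse is NOT in `Beta/` (`MultiscaleCombesThomasL2Cells` header: «no Dirichlet holes (the `dirInv` twin goes through
beta-d4-p2's `MultiscaleDecayDirichlet.hc_sandwich` the same way)») — THIS FILE writes that twin and complexifies it; ADDITIVE —
imports J3 file 1 (for §1's `opNorm_block_le`) + `Summits/QuantumFields/BalabanUV/Beta/MultiscaleDecayDirichlet` (beta-d4-p2, p-landed:
`hc_sandwich`, `decay_dirInv_levelOp`) ONLY and touches NO host; [folklore]; 0 `def`, 0 `def … : Prop`, 0 sorry, 0 citation tags of
Bałaban's.)

HONEST FRAMING.  Finite four-torus programme, rung (B)+1 only — NOT infinite volume, NOT a mass gap, NOT the Clay problem, NOT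
summit progress.  NE7c (`T4IndicatorShell.ShellWeightBound`) is NOT PRINTED in [Balaban 1983–89] and NOT PROVED; «NE7c ⇐ the named
binders» (trigger c3).  MODEL-side junction in the ℓ²-FIBRE reading, as file 1: the E6 row TYPE is inhabited by the cell blocks of
the Dirichlet-sectioned inverse with constants seeing `d, c, a, C, κ, S_max` only — NOT the domain `χ`, not the levels, their number
or the volume ((α4)+(α2)+(ℓ²-cell) of R-ne7cp1-g37-4 at MODEL level).  It does NOT say that Bałaban's local propagators `G′_□` of
[Balaban1985BackgroundPropagators] (3.86)–(3.88) ARE these objects (node O ∕ J1), nor the sup∕gradient members ((α3)), nor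
anything complexified (J6).  The gap `hcoer` is the Beta END's hypothesis.  Census COUNT unchanged; nothing of Bałaban's asserted,
cited or discharged.  HONEST DEPENDENCY (cell): continuum YM on T⁴ ⇐ BetaPertH ∧ nine spine estimates (0/9 proved); BetaPertH ⇐
(D1) ∧ (D4) ∧ CAP+tail; G-an2-4 gates asym, D1 and NE2/3/4.

CONTENT.  §1 **`real_cellNorm_dirInv_le`** — in the setting of `MultiscaleDecay.hc_levelOp` (verbatim section variables), for ANY
{0,1}-valued `χ`, cells `k, k′`, `u` supported in cell `k′`:
`√(Σ_{cell k}(dirInv A χ u)_p²) ≤ e^{−κ(d_n(t_k,t_{k′}) − 2d − 2d)}∕√((m₁S_{l_k}⁻²)(m₁S_{l_{k′}}⁻²))·√(Σ_{cell k′}u_p²)`, `m₁ = min(μ₀, 1)` —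
beta-d4-p3's `real_set_norm_inverse_le` fed by beta-d4-p2's `hc_sandwich` (the sandwich's conjugated coercivity, profile `m₁·n⁻²`),
invertibility from `decay_dirInv_levelOp`, thresholds from `sdist_corner_thresholds`, and `|χ| ≤ 1` on both sides of the sandwich.
§2 **`decayRow_dirInv_cells`** — the complexified cell block of `dirInv A χ` on `EuclideanSpace ℂ (UT N × Cp)` satisfies, for ALL
cells `c b′` and EVERY domain `χ`, `‖k c b′‖ ≤ (e^{4dκ}S_max²∕m₁)·exp(−(κ·sdist (corner c) (corner b′)))` — LITERALLY the host rows' shape.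
-/

noncomputable section

open Finset
open scoped Matrix ComplexConjugate BigOperators

namespace Summit.QuantumFields.BalabanUV.T4Continuum.ShellMeasureDecayRowsDirInvCells

open Summit.QuantumFields.BalabanUV.T4Continuum.ShellMeasureDecayRowsLevelOpCells (opNorm_block_le sq_form_of_sqrt_form)
open Summit.QuantumFields.BalabanUV.Beta
open Summit.QuantumFields.BalabanUV.Beta.BoxPoincare (Box)
open Summit.QuantumFields.BalabanUV.Beta.MultiscaleCoerciveTorus
open Summit.QuantumFields.BalabanUV.Beta.MultiscaleDistance
open Summit.QuantumFields.BalabanUV.Beta.MultiscaleDecayBudget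
open Summit.QuantumFields.BalabanUV.Beta.MultiscaleDecayDirichlet (hc_sandwich decay_dirInv_levelOp)
open Summit.QuantumFields.BalabanUV.Beta.MultiscaleCombesThomasL2Real (real_set_norm_inverse_le)
open Summit.QuantumFields.BalabanUV.Beta.AccretiveCombesThomasSandwichSite (sdist_corner_thresholds)
open Literature.MathematicalPhysics.QuantumFieldTheory.Balaban1983to89
open Literature.MathematicalPhysics.QuantumFieldTheory.Balaban1983to89.B9Thm37Sum (mulOp mulOp_apply)
open Literature.MathematicalPhysics.QuantumFieldTheory.Balaban1983to89.B9Thm37GluePU (bsrc btgt)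
open Literature.MathematicalPhysics.QuantumFieldTheory.Balaban1983to89.B9Thm37GlueTorusCov (tblk)
open Literature.MathematicalPhysics.QuantumFieldTheory.Balaban1983to89.B9Thm37GlueTorusCovLevels (levelOp)
open Literature.MathematicalPhysics.QuantumFieldTheory.Balaban1983to89.B9Thm37GlueTorusInv (dirInv)
open B5TorusCover (UT Ctr ctrU)

variable {d : ℕ} {N : Fin d → ℕ} [∀ i, NeZero (N i)] [NeZero d] {Cp J K : Type} [Fintype Cp] [DecidableEq Cp] [Nonempty Cp]
  [Fintype J] [Fintype K] [DecidableEq K] (S : J → ℕ) (hS : ∀ l, 1 ≤ S l) (hdivS : ∀ l i, S l ∣ N i) (lvl : K → J)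
  (zc : (k : K) → Ctr N (S (lvl k)))

/-! The analytic setting of `MultiscaleDecay.hc_levelOp`, as section variables (verbatim). -/

variable
    (hdisj : ∀ k k' v v', cellPt S hS hdivS lvl zc k v = cellPt S hS hdivS lvl zc k' v' → k = k')
    (hcover : ∀ x : UT N, ∃ k, ∃ v : Box d (S (lvl k)), cellPt S hS hdivS lvl zc k v = x)
    (Rm : UT N × Fin d → Cp → Cp → ℝ) (hRm : ∀ b i j, ∑ k, Rm b k i * Rm b k j = if i = j then (1 : ℝ) else 0)
    (T : J → UT N → Cp → Cp → ℝ) (hT : ∀ l x i i', ∑ k, T l x k i * T l x k i' = if i = i' then (1 : ℝ) else 0)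
    (a : J → ℝ) (ha : ∀ j, 0 ≤ a j) (ω : J → UT N → ℝ)
    (hsupp : ∀ l x, ω l (ctrU N (S l) (tblk (hS l) (hdivS l) x)) ≠ 0 → ∃ k v, lvl k = l ∧ cellPt S hS hdivS lvl zc k v = x)
    {amax : ℝ} (hamax : 0 ≤ amax)
    (hscale : ∀ k, a (lvl k) * ω (lvl k) (ctrU N (S (lvl k)) (zc k)) ^ 2 * (S (lvl k) : ℝ) ^ d ≤ amax / (S (lvl k) : ℝ) ^ 2)
    (c : UT N × Fin d → ℝ) {cmax : ℝ} (hc : ∀ b, |c b| ≤ cmax) {C : ℝ}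
    (hcoer : ∀ f : UT N × Cp → ℝ,
      C * ∑ k, ((S (lvl k) : ℝ) ^ 2)⁻¹ * ∑ v : Box d (S (lvl k)), ∑ i, f (cellPt S hS hdivS lvl zc k v, i) ^ 2 ≤
        ∑ p, f p * levelOp bsrc btgt c Rm (fun l x => ctrU N (S l) (tblk (hS l) (hdivS l) x))
          (fun l x => ω l (ctrU N (S l) (tblk (hS l) (hdivS l) x))) T a f p)
    {κ : ℝ} (hκ0 : 0 ≤ κ) (hκ1 : κ ≤ 1)

include hdisj hRm hT ha hsupp hamax hscale hc hcoer hκ0 hκ1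

/-! ## §1 The cell-to-cell ℓ² bound for the Dirichlet inverse (the `dirInv` twin of `MultiscaleCombesThomasL2Cells`) -/

/-- **THE ℓ²-LOCALIZED OPERATOR BOUND CELL TO CELL FOR THE DIRICHLET INVERSE `dirInv (levelOp) χ` (MODEL), EVERY DOMAIN.**  For
{0,1}-valued `χ`, cells `k, k′` with corners `t_k, t_{k′}` and a real `u` supported in cell `k′`:
`√(Σ_{p ∈ cell k}(dirInv A χ u)_p²) ≤ e^{−κ((d_n(t_k,t_{k′}) − 2d) − 2d)}∕√((m₁S_{l_k}⁻²)(m₁S_{l_{k′}}⁻²))·√(Σ_{p ∈ cell k′}u_p²)`,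
`m₁ = min(μ₀, 1)`, `μ₀ = C − 2d·c_max²κ² − a_max(e^{2dκ} − 1) > 0` — `real_set_norm_inverse_le` for the sandwich `Ω₀AΩ₀ + (1 − Ω₀)`
(hypothesis `hc_sandwich`, invertibility `decay_dirInv_levelOp`), then `dirInv A χ u = Ω₀(sandwich⁻¹(Ω₀u))` and `|χ| ≤ 1` on both sides;
constants seeing `d, c, a, C, κ` only — not the domain, not the sides, levels, their number or the volume. [folklore] -/
theorem real_cellNorm_dirInv_le (hμ : 0 < C - 2 * d * cmax ^ 2 * κ ^ 2 - amax * (Real.exp (2 * d * κ) - 1))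
    (χ : UT N × Cp → ℝ) (hχ : ∀ p, χ p = 0 ∨ χ p = 1)
    (k k' : K) (u : UT N × Cp → ℝ) (hu : ∀ p, cellOf S hS hdivS lvl zc hcover p.1 ≠ k' → u p = 0) :
    Real.sqrt (∑ p ∈ univ.filter (fun p : UT N × Cp => cellOf S hS hdivS lvl zc hcover p.1 = k),
        (dirInv (levelOp bsrc btgt c Rm (fun l x => ctrU N (S l) (tblk (hS l) (hdivS l) x))
          (fun l x => ω l (ctrU N (S l) (tblk (hS l) (hdivS l) x))) T a) χ) u p ^ 2) ≤
      Real.exp (-(κ * (sdist bsrc btgt (siteScale S hS hdivS lvl zc hcover) (ctrU N (S (lvl k)) (zc k))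
          (ctrU N (S (lvl k')) (zc k')) - 2 * d - 2 * d))) /
        Real.sqrt ((min (C - 2 * d * cmax ^ 2 * κ ^ 2 - amax * (Real.exp (2 * d * κ) - 1)) 1) * ((S (lvl k) : ℝ) ^ 2)⁻¹ *
          ((min (C - 2 * d * cmax ^ 2 * κ ^ 2 - amax * (Real.exp (2 * d * κ) - 1)) 1) * ((S (lvl k') : ℝ) ^ 2)⁻¹)) *
        Real.sqrt (∑ p ∈ univ.filter (fun p : UT N × Cp => cellOf S hS hdivS lvl zc hcover p.1 = k'), u p ^ 2) := by
  classical
  obtain ⟨i₀⟩ := ‹Nonempty Cp›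
  set μ₀ := C - 2 * d * cmax ^ 2 * κ ^ 2 - amax * (Real.exp (2 * d * κ) - 1) with hμ₀
  set A := levelOp bsrc btgt c Rm (fun l x => ctrU N (S l) (tblk (hS l) (hdivS l) x))
    (fun l x => ω l (ctrU N (S l) (tblk (hS l) (hdivS l) x))) T a with hA
  set Sw := (mulOp χ * A * mulOp χ + mulOp (1 - χ) : Module.End ℝ (UT N × Cp → ℝ)) with hSw
  set tk' : UT N := ctrU N (S (lvl k')) (zc k') with htk'
  have hm : 0 < min μ₀ 1 := lt_min hμ zero_lt_one
  -- invertibility of the sandwich (first conjunct of beta-d4-p2's Dirichlet END)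
  have hunit : IsUnit Sw :=
    (decay_dirInv_levelOp S hS hdivS lvl zc hdisj hcover Rm hRm T hT a ha ω hsupp hamax hscale c hc hcoer hκ0 hκ1 hμ χ hχ
      (tk', i₀) (tk', i₀)).1
  -- the sitewise profile and its positivity
  have hSpos : ∀ l, (0 : ℝ) < (S l : ℝ) := fun l => by exact_mod_cast hS l
  have hμpos : ∀ p : UT N × Cp, 0 < min μ₀ 1 * ((siteScale S hS hdivS lvl zc hcover p.1 : ℝ) ^ 2)⁻¹ := fun p =>
    mul_pos hm (inv_pos.mpr (pow_pos (by exact_mod_cast one_le_siteScale S hS hdivS lvl zc hcover p.1) 2))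
  -- the conjugated-pairing hypothesis of the SANDWICH along the site weight `κ·d_n(·, t_{k′})` = `hc_sandwich` verbatim
  have hcH : ∀ v : UT N × Cp → ℝ, ∑ p, min μ₀ 1 * ((siteScale S hS hdivS lvl zc hcover p.1 : ℝ) ^ 2)⁻¹ * v p ^ 2 ≤
      ∑ p, Real.exp (κ * sdist bsrc btgt (siteScale S hS hdivS lvl zc hcover) p.1 tk') * v p *
        Sw (fun q => Real.exp (-(κ * sdist bsrc btgt (siteScale S hS hdivS lvl zc hcover) q.1 tk')) * v q) p :=
    fun v => hc_sandwich S hS hdivS lvl zc hdisj hcover Rm hRm T hT a ha ω hsupp hamax hscale c hc hcoer hκ0 hκ1 χ hχ (tk', i₀) v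
  -- thresholds on the two cells (K4 §6)
  have hthr := sdist_corner_thresholds S hS hdivS lvl zc hdisj hcover
  -- the truncated source `Ω₀u` is supported in cell `k′`
  have hχabs : ∀ r, |χ r| ≤ 1 := fun r => by rcases hχ r with h | h <;> simp [h]
  have hχu : ∀ p : UT N × Cp, p ∉ univ.filter (fun p : UT N × Cp => cellOf S hS hdivS lvl zc hcover p.1 = k') →
      χ p * u p = 0 := fun p hp => by
    rw [hu p (fun h => hp (mem_filter.mpr ⟨mem_univ _, h⟩)), mul_zero]
  -- file 6 for the sandwich and the truncated source
  have h6 := real_set_norm_inverse_le hunit hμpos hκ0 hcH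
    (univ.filter (fun p : UT N × Cp => cellOf S hS hdivS lvl zc hcover p.1 = k))
    (univ.filter (fun p : UT N × Cp => cellOf S hS hdivS lvl zc hcover p.1 = k'))
    (u := fun p => χ p * u p) hχu
    (mul_pos hm (inv_pos.mpr (pow_pos (hSpos (lvl k)) 2)))
    (mul_pos hm (inv_pos.mpr (pow_pos (hSpos (lvl k')) 2)))
    (fun p hp => by
      have hpk : cellOf S hS hdivS lvl zc hcover p.1 = k := (mem_filter.mp hp).2
      have h := (hthr p.1 k').2
      rw [hpk] at h
      exact h)
    (fun p hp => (hthr p.1 k').1 (mem_filter.mp hp).2)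
    (fun p hp => by
      have hpk : cellOf S hS hdivS lvl zc hcover p.1 = k := (mem_filter.mp hp).2
      have hn : siteScale S hS hdivS lvl zc hcover p.1 = S (lvl k) := by rw [siteScale, hpk]
      rw [hn])
    (fun p hp => by
      have hpk : cellOf S hS hdivS lvl zc hcover p.1 = k' := (mem_filter.mp hp).2
      have hn : siteScale S hS hdivS lvl zc hcover p.1 = S (lvl k') := by rw [siteScale, hpk]
      rw [hn])
  -- `dirInv A χ u = Ω₀ (Sw⁻¹ (Ω₀ u))`, and `|χ| ≤ 1` on both sides
  have hdir : ∀ p, dirInv A χ u p = χ p * (Ring.inverse Sw) (fun q => χ q * u q) p := by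
    intro p
    have e : mulOp χ u = fun q => χ q * u q := funext fun q => mulOp_apply χ u q
    rw [dirInv, Module.End.mul_apply, Module.End.mul_apply, e, mulOp_apply]
  have hL : ∑ p ∈ univ.filter (fun p : UT N × Cp => cellOf S hS hdivS lvl zc hcover p.1 = k), dirInv A χ u p ^ 2 ≤
      ∑ p ∈ univ.filter (fun p : UT N × Cp => cellOf S hS hdivS lvl zc hcover p.1 = k),
        (Ring.inverse Sw) (fun q => χ q * u q) p ^ 2 := by
    refine sum_le_sum fun p _ => ?_
    rw [hdir p, mul_pow]
    have h1 : χ p ^ 2 ≤ 1 := by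
      have := hχabs p
      rw [abs_le] at this
      nlinarith [this.1, this.2]
    nlinarith [sq_nonneg ((Ring.inverse Sw) (fun q => χ q * u q) p)]
  have hR : ∑ p ∈ univ.filter (fun p : UT N × Cp => cellOf S hS hdivS lvl zc hcover p.1 = k'), (χ p * u p) ^ 2 ≤
      ∑ p ∈ univ.filter (fun p : UT N × Cp => cellOf S hS hdivS lvl zc hcover p.1 = k'), u p ^ 2 := by
    refine sum_le_sum fun p _ => ?_
    rw [mul_pow]
    have h1 : χ p ^ 2 ≤ 1 := by
      have := hχabs p
      rw [abs_le] at this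
      nlinarith [this.1, this.2]
    nlinarith [sq_nonneg (u p)]
  have hE0 : 0 ≤ Real.exp (-(κ * (sdist bsrc btgt (siteScale S hS hdivS lvl zc hcover) (ctrU N (S (lvl k)) (zc k)) tk' -
      2 * d - 2 * d))) /
      Real.sqrt (min μ₀ 1 * ((S (lvl k) : ℝ) ^ 2)⁻¹ * (min μ₀ 1 * ((S (lvl k') : ℝ) ^ 2)⁻¹)) :=
    div_nonneg (Real.exp_pos _).le (Real.sqrt_nonneg _)
  calc Real.sqrt (∑ p ∈ univ.filter (fun p : UT N × Cp => cellOf S hS hdivS lvl zc hcover p.1 = k), dirInv A χ u p ^ 2)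
      ≤ Real.sqrt (∑ p ∈ univ.filter (fun p : UT N × Cp => cellOf S hS hdivS lvl zc hcover p.1 = k),
          (Ring.inverse Sw) (fun q => χ q * u q) p ^ 2) := Real.sqrt_le_sqrt hL
    _ ≤ _ := h6
    _ ≤ _ := mul_le_mul_of_nonneg_left (Real.sqrt_le_sqrt hR) hE0

/-! ## §2 The E6-row shape for the Dirichlet-sectioned inverse, every domain -/

/-- **ROW J3 (SECTIONED) — THE DECAY-ROW SHAPE `‖k c b′‖ ≤ c𝒢·e^{−(δ𝒢·dis (pos c) (pos b′))}` INHABITED BY THE CELL BLOCKS OF THE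
DIRICHLET INVERSE `dirInv (levelOp) χ` ON THE ℓ²-FIBRE, FOR EVERY DOMAIN `χ`.**  With `m₁ = min(μ₀, 1)`, `μ₀ > 0` as above and
cell sides `S_{l_k} ≤ S_max`: for ALL cells `c b′` and every {0,1}-valued `χ`,
`‖toEuclideanCLM ((of fun p q => [cell p = c][cell q = b′]·((dirInv A χ) e_q)_p).map ofReal)‖ ≤ (e^{4dκ}·S_max²∕m₁)·exp(−(κ·sdist (corner c) (corner b′)))`
— the host rows' shape with `c𝒢 := e^{4dκ}S_max²∕m₁` INDEPENDENT of the domain (and of levels, their number, the volume, the cell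
cardinalities), `δ𝒢 := κ`, `pos := corner`, `dis := sdist`; = §1 squared ∘ file 1's `opNorm_block_le`. [folklore] -/
theorem decayRow_dirInv_cells (hμ : 0 < C - 2 * d * cmax ^ 2 * κ ^ 2 - amax * (Real.exp (2 * d * κ) - 1))
    (χ : UT N × Cp → ℝ) (hχ : ∀ p, χ p = 0 ∨ χ p = 1)
    {Smax : ℝ} (hSmax : ∀ k, (S (lvl k) : ℝ) ≤ Smax) (cc b' : K) :
    ‖Matrix.toEuclideanCLM (n := UT N × Cp) (𝕜 := ℂ)
        ((Matrix.of fun p q : UT N × Cp =>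
          if cellOf S hS hdivS lvl zc hcover p.1 = cc ∧ cellOf S hS hdivS lvl zc hcover q.1 = b' then
            (dirInv (levelOp bsrc btgt c Rm (fun l x => ctrU N (S l) (tblk (hS l) (hdivS l) x))
              (fun l x => ω l (ctrU N (S l) (tblk (hS l) (hdivS l) x))) T a) χ) (Pi.single q 1) p
          else 0).map Complex.ofReal)‖ ≤
      (Real.exp (4 * d * κ) * Smax ^ 2 / min (C - 2 * d * cmax ^ 2 * κ ^ 2 - amax * (Real.exp (2 * d * κ) - 1)) 1) *
        Real.exp (-(κ * sdist bsrc btgt (siteScale S hS hdivS lvl zc hcover) (ctrU N (S (lvl cc)) (zc cc))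
          (ctrU N (S (lvl b')) (zc b')))) := by
  classical
  set μ₀ := C - 2 * d * cmax ^ 2 * κ ^ 2 - amax * (Real.exp (2 * d * κ) - 1) with hμ₀
  set G := dirInv (levelOp bsrc btgt c Rm (fun l x => ctrU N (S l) (tblk (hS l) (hdivS l) x))
    (fun l x => ω l (ctrU N (S l) (tblk (hS l) (hdivS l) x))) T a) χ with hG
  set sd := sdist bsrc btgt (siteScale S hS hdivS lvl zc hcover) (ctrU N (S (lvl cc)) (zc cc))
    (ctrU N (S (lvl b')) (zc b')) with hsd
  set Xc : Finset (UT N × Cp) := univ.filter (fun p => cellOf S hS hdivS lvl zc hcover p.1 = cc) with hXc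
  set Xb : Finset (UT N × Cp) := univ.filter (fun p => cellOf S hS hdivS lvl zc hcover p.1 = b') with hXb
  have hm : 0 < min μ₀ 1 := lt_min hμ zero_lt_one
  have hSpos : ∀ k, (0 : ℝ) < (S (lvl k) : ℝ) := fun k => by exact_mod_cast hS (lvl k)
  have hSmax0 : 0 < Smax := (hSpos cc).trans_le (hSmax cc)
  have hν : ∀ k, 0 < min μ₀ 1 * ((S (lvl k) : ℝ) ^ 2)⁻¹ := fun k => mul_pos hm (inv_pos.mpr (pow_pos (hSpos k) 2))
  set B : ℝ := Real.exp (-(κ * (sd - 2 * d - 2 * d))) /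
      Real.sqrt (min μ₀ 1 * ((S (lvl cc) : ℝ) ^ 2)⁻¹ * (min μ₀ 1 * ((S (lvl b') : ℝ) ^ 2)⁻¹)) with hB
  have hB0 : 0 ≤ B := div_nonneg (Real.exp_pos _).le (Real.sqrt_nonneg _)
  have hblock : ‖Matrix.toEuclideanCLM (n := UT N × Cp) (𝕜 := ℂ)
      ((Matrix.of fun p q : UT N × Cp => if p ∈ Xc ∧ q ∈ Xb then G (Pi.single q 1) p else 0).map Complex.ofReal)‖ ≤ B := by
    refine opNorm_block_le G Xc Xb hB0 fun u hu => ?_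
    have hu' : ∀ p : UT N × Cp, cellOf S hS hdivS lvl zc hcover p.1 ≠ b' → u p = 0 :=
      fun p hp => hu p (fun hmem => hp (mem_filter.mp hmem).2)
    have h := real_cellNorm_dirInv_le S hS hdivS lvl zc hdisj hcover Rm hRm T hT a ha ω hsupp hamax hscale c hc hcoer hκ0 hκ1
      hμ χ hχ cc b' u hu'
    have h' : Real.sqrt (∑ p ∈ Xc, G u p ^ 2) ≤ B * Real.sqrt (∑ p ∈ Xb, u p ^ 2) := by
      rw [hB, hXc, hXb, hG]
      exact h
    exact sq_form_of_sqrt_form (sum_nonneg fun _ _ => sq_nonneg _) h' (sum_nonneg fun _ _ => sq_nonneg _)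
  have hmat : (Matrix.of fun p q : UT N × Cp =>
      if cellOf S hS hdivS lvl zc hcover p.1 = cc ∧ cellOf S hS hdivS lvl zc hcover q.1 = b' then G (Pi.single q 1) p
      else 0) = (Matrix.of fun p q : UT N × Cp => if p ∈ Xc ∧ q ∈ Xb then G (Pi.single q 1) p else 0) := by
    ext p q
    simp only [Matrix.of_apply, hXc, hXb, mem_filter, mem_univ, true_and]
  rw [hmat]
  refine hblock.trans ?_
  have hexp : Real.exp (-(κ * (sd - 2 * d - 2 * d))) = Real.exp (4 * d * κ) * Real.exp (-(κ * sd)) := by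
    rw [← Real.exp_add]; ring_nf
  have hsqrt_ge : min μ₀ 1 / Smax ^ 2 ≤
      Real.sqrt (min μ₀ 1 * ((S (lvl cc) : ℝ) ^ 2)⁻¹ * (min μ₀ 1 * ((S (lvl b') : ℝ) ^ 2)⁻¹)) := by
    have h1 : min μ₀ 1 / Smax ^ 2 ≤ min μ₀ 1 * ((S (lvl cc) : ℝ) ^ 2)⁻¹ := by
      rw [div_eq_mul_inv]
      exact mul_le_mul_of_nonneg_left (inv_anti₀ (pow_pos (hSpos cc) 2)
        (pow_le_pow_left₀ (hSpos cc).le (hSmax cc) 2)) hm.le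
    have h2 : min μ₀ 1 / Smax ^ 2 ≤ min μ₀ 1 * ((S (lvl b') : ℝ) ^ 2)⁻¹ := by
      rw [div_eq_mul_inv]
      exact mul_le_mul_of_nonneg_left (inv_anti₀ (pow_pos (hSpos b') 2)
        (pow_le_pow_left₀ (hSpos b').le (hSmax b') 2)) hm.le
    have h0 : 0 ≤ min μ₀ 1 / Smax ^ 2 := by positivity
    calc min μ₀ 1 / Smax ^ 2 = Real.sqrt ((min μ₀ 1 / Smax ^ 2) * (min μ₀ 1 / Smax ^ 2)) := (Real.sqrt_mul_self h0).symm
      _ ≤ _ := Real.sqrt_le_sqrt (mul_le_mul h1 h2 h0 (hν cc).le)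
  have hμS : 0 < min μ₀ 1 / Smax ^ 2 := by positivity
  calc B = Real.exp (4 * d * κ) * Real.exp (-(κ * sd)) /
        Real.sqrt (min μ₀ 1 * ((S (lvl cc) : ℝ) ^ 2)⁻¹ * (min μ₀ 1 * ((S (lvl b') : ℝ) ^ 2)⁻¹)) := by rw [hB, hexp]
    _ ≤ Real.exp (4 * d * κ) * Real.exp (-(κ * sd)) / (min μ₀ 1 / Smax ^ 2) :=
        div_le_div_of_nonneg_left (by positivity) hμS hsqrt_ge
    _ = Real.exp (4 * d * κ) * Smax ^ 2 / min μ₀ 1 * Real.exp (-(κ * sd)) := by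
        field_simp

end Summit.QuantumFields.BalabanUV.T4Continuum.ShellMeasureDecayRowsDirInvCells

end
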